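import Mathlib
import Literature.NumberTheory.Sieve.LinearCongruencePairs
import Literature.NumberTheory.Sieve.LinearPairMoebiusMainTerm
import Literature.NumberTheory.Sieve.HyperbolicShellPairCounts
import HarnessLib

/-!
# The balanced divisor window for a pair of linear congruences: exact decomposition into the
# main term and sawtooth sums, and the bookkeeping of the weights

Topic `Literature/NumberTheory/Sieve` (companion of `LinearCongruencePairs.lean`,
`LinearPairMoebiusMainTerm.lean`; input of the Duke–Friedlander–Iwaniec treatment of the balanced
range of the binary divisor problem `Σ_n Σ_{d₀ ∣ q₀n+a₀, d₁ ∣ q₁n+a₁} G(d₀,d₁)`).  For primitive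
linear forms `qᵢ n + aᵢ` (`gcd(qᵢ,aᵢ) = 1`, `Δ = q₁a₀ − q₀a₁`), a weight `G(d₀,d₁)`, a threshold
`n₀ ≤ x` and a solution map `ν` of the pair of congruences:

* `card_pair_eq` — the count `A(d; x) = #{n₀ < n ≤ x : d₀ ∣ q₀n+a₀, d₁ ∣ q₁n+a₁}` equals
  `[Sol(d)] ((x − n₀)/L + ψ((n₀ − ν)/L) − ψ((x − ν)/L))`, `L = lcm(d₀,d₁)`, `ψ = saw`
  (`LinearCongruencePair.card_Ioc_filter_pair_eq_saw`, `pair_solvable_iff`);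
* `window_sum_decomp` — hence `Σ_d G(d) A(d;x) = (x − n₀) Σ_d [Sol] G/L + Ψ(n₀) − Ψ(x)` with the
  SAWTOOTH SUMS `Ψ(y) = Σ_d [Sol(d)] G(d) ψ((y − ν_d)/L_d)`;
* `mainTerm_summand_eq` — `[Sol] G/L` in the form of `LinearPairMoebius.abs_doubleSum_le` for the
  Möbius–log window weight `G = [x^{1−η} < d₀d₁ ≤ x^{1+θ}][x^σ < dᵢ] μ(d₀) log d₀ μ(d₁) log d₁`;
* `expSum_eq_windowSum`, `abs_window_weight`, `norm_trunc_weight_le`, `sum_abs_window_weight_le` —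
  the exponential sums `Σ_d [Sol] G(d) e(k(y − ν_d)/L_d)` (and with `|G|`) in the form of
  `LinearPairKloosterman.norm_windowSum_le`, and the size of the `k = 0` term
  (`≤ log B₀ log B₁ · x^{1+θ}(1 + log x^{1+θ})`, lattice points under a hyperbola).

Everything here is PROVED.

## References

* D. R. Heath-Brown, Proc. London Math. Soc. (3) 82 (2001), §3 (3.2) (`#𝒜 = X/N + ψ − ψ`);
  W. Duke, J. Friedlander, H. Iwaniec, Invent. Math. 128 (1997) (the balanced range). [folklore]
-/

open scoped BigOperators ArithmeticFunction.Moebius FourierTransform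
open Finset Real

namespace Literature.NumberTheory.Sieve.LinearPairMoebius

open Literature.NumberTheory.Sieve.LinearCongruencePair
open Literature.NumberTheory.LFunctions.AFE (saw)

section Pair

variable {q₀ q₁ : ℕ} {a₀ a₁ : ℤ}

/-! ### The count as main term plus sawtooth values -/

/-- **The count of `n₀ < n ≤ x` with `d₀ ∣ q₀n + a₀`, `d₁ ∣ q₁n + a₁`.**  For `gcd(qᵢ,aᵢ) = 1`,
`dᵢ ≥ 1`, `n₀ ≤ x` and a solution `ν` of the pair whenever it is solvable
(`Sol(d) :⇔ gcd(d₀,q₀) = gcd(d₁,q₁) = 1 ∧ gcd(d₀,d₁) ∣ Δ`):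
`A(d; x) = [Sol(d)] ((x − n₀)/L + ψ((n₀ − ν)/L) − ψ((x − ν)/L))`, `L = lcm(d₀, d₁)`. [folklore] -/
theorem card_pair_eq (hc₀ : IsCoprime (q₀ : ℤ) a₀) (hc₁ : IsCoprime (q₁ : ℤ) a₁) {d₀ d₁ : ℕ}
    (hd₀ : 0 < d₀) (hd₁ : 0 < d₁) {ν : ℕ}
    (hν : (Nat.Coprime d₀ q₀ ∧ Nat.Coprime d₁ q₁ ∧
      ((Nat.gcd d₀ d₁ : ℕ) : ℤ) ∣ (q₁ : ℤ) * a₀ - (q₀ : ℤ) * a₁) →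
        (d₀ : ℤ) ∣ (q₀ : ℤ) * ν + a₀ ∧ (d₁ : ℤ) ∣ (q₁ : ℤ) * ν + a₁)
    {n₀ x : ℕ} (hn : n₀ ≤ x) :
    ((((Ioc n₀ x).filter (fun n : ℕ =>
        (d₀ : ℤ) ∣ (q₀ : ℤ) * n + a₀ ∧ (d₁ : ℤ) ∣ (q₁ : ℤ) * n + a₁)).card : ℕ) : ℝ) =
      if (Nat.Coprime d₀ q₀ ∧ Nat.Coprime d₁ q₁ ∧
          ((Nat.gcd d₀ d₁ : ℕ) : ℤ) ∣ (q₁ : ℤ) * a₀ - (q₀ : ℤ) * a₁) then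
        ((x - n₀ : ℕ) : ℝ) / (Nat.lcm d₀ d₁ : ℕ) + saw (((n₀ : ℝ) - ν) / (Nat.lcm d₀ d₁ : ℕ)) -
          saw (((x : ℝ) - ν) / (Nat.lcm d₀ d₁ : ℕ))
      else 0 := by
  have hx : x = n₀ + (x - n₀) := (Nat.add_sub_cancel' hn).symm
  by_cases hs : (Nat.Coprime d₀ q₀ ∧ Nat.Coprime d₁ q₁ ∧
      ((Nat.gcd d₀ d₁ : ℕ) : ℤ) ∣ (q₁ : ℤ) * a₀ - (q₀ : ℤ) * a₁)
  · rw [if_pos hs]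
    obtain ⟨hν₀, hν₁⟩ := hν hs
    have h := card_Ioc_filter_pair_eq_saw hc₀ hc₁ hd₀ hd₁ hν₀ hν₁ n₀ (x - n₀)
    rw [← hx] at h
    rw [h]
    congr 3
    push_cast [hn]
    ring
  · rw [if_neg hs]
    have hns : ¬ ∃ n : ℤ, (d₀ : ℤ) ∣ (q₀ : ℤ) * n + a₀ ∧ (d₁ : ℤ) ∣ (q₁ : ℤ) * n + a₁ := by
      intro h
      obtain ⟨h0, h1, h2⟩ := (pair_solvable_iff hc₀ hc₁).1 h
      exact hs ⟨Nat.isCoprime_iff_coprime.1 h0, Nat.isCoprime_iff_coprime.1 h1, h2⟩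
    rw [card_Ioc_filter_pair_eq_zero hns, Nat.cast_zero]

/-- **The window sum as main term plus two sawtooth sums.**  For any weight `G`, a threshold
`n₀ ≤ x`, box sides `B₀, B₁` and a solution map `ν`:
`Σ_{d₀ ≤ B₀, d₁ ≤ B₁} G(d) A(d; x) = (x − n₀) Σ_d [Sol] G/L + Σ_d [Sol] G ψ((n₀ − ν_d)/L_d)
  − Σ_d [Sol] G ψ((x − ν_d)/L_d)`. [folklore] -/
theorem window_sum_decomp (hc₀ : IsCoprime (q₀ : ℤ) a₀) (hc₁ : IsCoprime (q₁ : ℤ) a₁)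
    (ν : ℕ → ℕ → ℕ)
    (hν : ∀ d₀ d₁ : ℕ, 0 < d₀ → 0 < d₁ → Nat.Coprime d₀ q₀ → Nat.Coprime d₁ q₁ →
      ((Nat.gcd d₀ d₁ : ℕ) : ℤ) ∣ (q₁ : ℤ) * a₀ - (q₀ : ℤ) * a₁ →
        (d₀ : ℤ) ∣ (q₀ : ℤ) * (ν d₀ d₁) + a₀ ∧ (d₁ : ℤ) ∣ (q₁ : ℤ) * (ν d₀ d₁) + a₁)
    (G : ℕ → ℕ → ℝ) (B₀ B₁ : ℕ) {n₀ x : ℕ} (hn : n₀ ≤ x) :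
    ∑ d₀ ∈ Icc 1 B₀, ∑ d₁ ∈ Icc 1 B₁, G d₀ d₁ *
        ((((Ioc n₀ x).filter (fun n : ℕ =>
          (d₀ : ℤ) ∣ (q₀ : ℤ) * n + a₀ ∧ (d₁ : ℤ) ∣ (q₁ : ℤ) * n + a₁)).card : ℕ) : ℝ) =
      ((x - n₀ : ℕ) : ℝ) * ∑ d₀ ∈ Icc 1 B₀, ∑ d₁ ∈ Icc 1 B₁,
          (if (Nat.Coprime d₀ q₀ ∧ Nat.Coprime d₁ q₁ ∧
              ((Nat.gcd d₀ d₁ : ℕ) : ℤ) ∣ (q₁ : ℤ) * a₀ - (q₀ : ℤ) * a₁) then G d₀ d₁ else 0) /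
            (Nat.lcm d₀ d₁ : ℕ) +
        ∑ d₀ ∈ Icc 1 B₀, ∑ d₁ ∈ Icc 1 B₁,
          (if (Nat.Coprime d₀ q₀ ∧ Nat.Coprime d₁ q₁ ∧
              ((Nat.gcd d₀ d₁ : ℕ) : ℤ) ∣ (q₁ : ℤ) * a₀ - (q₀ : ℤ) * a₁) then G d₀ d₁ else 0) *
            saw (((n₀ : ℝ) - ν d₀ d₁) / (Nat.lcm d₀ d₁ : ℕ)) -
        ∑ d₀ ∈ Icc 1 B₀, ∑ d₁ ∈ Icc 1 B₁,
          (if (Nat.Coprime d₀ q₀ ∧ Nat.Coprime d₁ q₁ ∧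
              ((Nat.gcd d₀ d₁ : ℕ) : ℤ) ∣ (q₁ : ℤ) * a₀ - (q₀ : ℤ) * a₁) then G d₀ d₁ else 0) *
            saw (((x : ℝ) - ν d₀ d₁) / (Nat.lcm d₀ d₁ : ℕ)) := by
  rw [Finset.mul_sum, ← Finset.sum_add_distrib, ← Finset.sum_sub_distrib]
  refine Finset.sum_congr rfl fun d₀ hd₀ => ?_
  rw [Finset.mul_sum, ← Finset.sum_add_distrib, ← Finset.sum_sub_distrib]
  refine Finset.sum_congr rfl fun d₁ hd₁ => ?_
  have hd₀pos : 0 < d₀ := (Finset.mem_Icc.1 hd₀).1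
  have hd₁pos : 0 < d₁ := (Finset.mem_Icc.1 hd₁).1
  rw [card_pair_eq hc₀ hc₁ hd₀pos hd₁pos (fun h => hν d₀ d₁ hd₀pos hd₁pos h.1 h.2.1 h.2.2) hn]
  split_ifs
  · ring
  · simp

/-! ### The main-term summand for the Möbius–log window weight -/

/-- For the window weight `G = [x^{1−η} < d₀d₁ ≤ x^{1+θ}][x^σ < d₀][x^σ < d₁] μ(d₀)log d₀ μ(d₁)log d₁`
and `dᵢ ≥ 1`: `[Sol(d)] G(d)/lcm(d₀,d₁)` is the summand of `LinearPairMoebius.abs_doubleSum_le`,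
`(μ(d₀)log d₀/d₀) [gcd(d₀,q₀)=1] [window] [gcd(d₁,q₁)=1 ∧ gcd(d₀,d₁) ∣ Δ] μ(d₁) log d₁ gcd(d₀,d₁)/d₁`
(`1/lcm = gcd/(d₀d₁)`). [folklore] -/
theorem mainTerm_summand_eq (Δ : ℤ) (σ θ η X : ℝ) {d₀ d₁ : ℕ} (hd₀ : 0 < d₀) (hd₁ : 0 < d₁) :
    (if (Nat.Coprime d₀ q₀ ∧ Nat.Coprime d₁ q₁ ∧ ((Nat.gcd d₀ d₁ : ℕ) : ℤ) ∣ Δ) then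
        (if (X ^ (1 - η) < (d₀ : ℝ) * d₁ ∧ (d₀ : ℝ) * d₁ ≤ X ^ (1 + θ) ∧
            X ^ σ < (d₀ : ℝ) ∧ X ^ σ < (d₁ : ℝ)) then
          (μ d₀ : ℝ) * Real.log d₀ * ((μ d₁ : ℝ) * Real.log d₁) else 0) else 0) /
        (Nat.lcm d₀ d₁ : ℕ) =
      (μ d₀ : ℝ) * Real.log d₀ / d₀ * ((if Nat.Coprime d₀ q₀ then (1 : ℝ) else 0) *
        (if (X ^ (1 - η) < (d₀ : ℝ) * d₁ ∧ (d₀ : ℝ) * d₁ ≤ X ^ (1 + θ) ∧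
            X ^ σ < (d₀ : ℝ) ∧ X ^ σ < (d₁ : ℝ)) then
          (if Nat.Coprime d₁ q₁ ∧ ((Nat.gcd d₀ d₁ : ℕ) : ℤ) ∣ Δ then
            (μ d₁ : ℝ) * Real.log d₁ * ((Nat.gcd d₀ d₁ : ℝ) / d₁) else 0) else 0)) := by
  have hL : ((Nat.lcm d₀ d₁ : ℕ) : ℝ) = (d₀ : ℝ) * d₁ / (Nat.gcd d₀ d₁ : ℕ) := by
    have h := Nat.gcd_mul_lcm d₀ d₁
    have hg : (0 : ℝ) < (Nat.gcd d₀ d₁ : ℕ) := by exact_mod_cast Nat.gcd_pos_of_pos_left _ hd₀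
    rw [eq_div_iff hg.ne']
    have : ((Nat.gcd d₀ d₁ * Nat.lcm d₀ d₁ : ℕ) : ℝ) = ((d₀ * d₁ : ℕ) : ℝ) := by rw [h]
    push_cast at this
    linarith
  have hd₀R : (0 : ℝ) < d₀ := by exact_mod_cast hd₀
  have hd₁R : (0 : ℝ) < d₁ := by exact_mod_cast hd₁
  have hg0 : (0 : ℝ) < (Nat.gcd d₀ d₁ : ℕ) := by exact_mod_cast Nat.gcd_pos_of_pos_left _ hd₀
  rw [hL]
  by_cases hw : (X ^ (1 - η) < (d₀ : ℝ) * d₁ ∧ (d₀ : ℝ) * d₁ ≤ X ^ (1 + θ) ∧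
      X ^ σ < (d₀ : ℝ) ∧ X ^ σ < (d₁ : ℝ))
  · simp only [if_pos hw]
    by_cases h0 : Nat.Coprime d₀ q₀
    · by_cases h1 : Nat.Coprime d₁ q₁ ∧ ((Nat.gcd d₀ d₁ : ℕ) : ℤ) ∣ Δ
      · rw [if_pos ⟨h0, h1⟩, if_pos h0, if_pos h1]
        field_simp
      · rw [if_neg (fun h => h1 h.2), if_pos h0, if_neg h1]
        simp
    · rw [if_neg (fun h => h0 h.1), if_neg h0]
      simp
  · simp only [if_neg hw]
    split_ifs <;> simp

/-! ### The exponential sums in the form of `LinearPairKloosterman.norm_windowSum_le` -/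

/-- `e(a) = exp(2πi a)` with the two spellings used in the tree. [folklore] -/
theorem fourierChar_coe_eq_exp (a : ℝ) :
    (𝐞 a : ℂ) = Complex.exp (2 * π * Complex.I * (a : ℂ)) := by
  rw [Real.fourierChar_apply]
  congr 1
  push_cast
  ring

/-- **The exponential sum over the window as a double sum with truncated weights.**  For real
`u₀, u₁`, a predicate-free rendering: with `w(d) = [P(d)] u₀(d₀) u₁(d₁)` on `[1,B₀]×[1,B₁]` and
`vᵢ(d) = [d ≤ Bᵢ] uᵢ(d)`,
`Σ_{p ∈ [1,B₀]×[1,B₁]} w(p) e(k t_p) = Σ_{d₀ ≤ B₀} Σ_{d₁ ≤ B₁} [P(d)] v₀(d₀) v₁(d₁) exp(2πi k t_d)`.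
[folklore] -/
theorem expSum_eq_windowSum (P : ℕ → ℕ → Prop) [DecidablePred fun p : ℕ × ℕ => P p.1 p.2]
    [∀ d₀ d₁, Decidable (P d₀ d₁)]
    (u₀ u₁ : ℕ → ℝ) (t : ℕ → ℕ → ℝ) (B₀ B₁ : ℕ) (k : ℝ) :
    ∑ p ∈ Icc 1 B₀ ×ˢ Icc 1 B₁,
        (((if P p.1 p.2 then u₀ p.1 * u₁ p.2 else 0 : ℝ) : ℂ) * (𝐞 (k * t p.1 p.2) : ℂ)) =
      ∑ d₀ ∈ Icc 1 B₀, ∑ d₁ ∈ Icc 1 B₁,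
        (if P d₀ d₁ then
          (if d₀ ≤ B₀ then ((u₀ d₀ : ℝ) : ℂ) else 0) * (if d₁ ≤ B₁ then ((u₁ d₁ : ℝ) : ℂ) else 0) *
            Complex.exp (2 * π * Complex.I * ((k * t d₀ d₁ : ℝ) : ℂ))
        else 0) := by
  rw [Finset.sum_product]
  refine Finset.sum_congr rfl fun d₀ hd₀ => Finset.sum_congr rfl fun d₁ hd₁ => ?_
  have h0 : d₀ ≤ B₀ := (Finset.mem_Icc.1 hd₀).2
  have h1 : d₁ ≤ B₁ := (Finset.mem_Icc.1 hd₁).2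
  rw [if_pos h0, if_pos h1, fourierChar_coe_eq_exp]
  by_cases hP : P d₀ d₁
  · rw [if_pos hP, if_pos hP]; push_cast; ring
  · rw [if_neg hP, if_neg hP]; simp

/-- The absolute value of the window weight `[P] u₀ u₁` is the window weight of `|u₀|, |u₁|`.
[folklore] -/
theorem abs_window_weight (P : Prop) [Decidable P] (a b : ℝ) :
    |(if P then a * b else 0 : ℝ)| = if P then |a| * |b| else 0 := by
  split_ifs
  · exact abs_mul a b
  · exact abs_zero

/-- Size of the truncated Möbius–log weights: `‖[d ≤ B] μ(d) log d‖, ‖[d ≤ B] |μ(d)| log d‖ ≤ log B`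
for `B ≥ 1`. [folklore] -/
theorem norm_trunc_weight_le {B : ℕ} (hB : 1 ≤ B) (d : ℕ) :
    ‖(if d ≤ B then (((μ d : ℝ) * Real.log d : ℝ) : ℂ) else 0)‖ ≤ Real.log B ∧
      ‖(if d ≤ B then (((|(μ d : ℝ)| * Real.log d : ℝ)) : ℂ) else 0)‖ ≤ Real.log B := by
  have hB0 : 0 ≤ Real.log B := Real.log_nonneg (by exact_mod_cast hB)
  by_cases hd : d ≤ B
  · rw [if_pos hd, if_pos hd, Complex.norm_real, Complex.norm_real, Real.norm_eq_abs,
      Real.norm_eq_abs, abs_mul, abs_mul, abs_abs]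
    have hμ : |(μ d : ℝ)| ≤ 1 := by exact_mod_cast ArithmeticFunction.abs_moebius_le_one
    have hlog : |Real.log d| ≤ Real.log B := by
      rcases Nat.eq_zero_or_pos d with rfl | hdpos
      · simp [hB0]
      · rw [abs_of_nonneg (Real.log_nonneg (by exact_mod_cast hdpos))]
        exact Real.log_le_log (by exact_mod_cast hdpos) (by exact_mod_cast hd)
    have : |(μ d : ℝ)| * |Real.log d| ≤ 1 * Real.log B :=
      mul_le_mul hμ hlog (abs_nonneg _) zero_le_one
    rw [one_mul] at this
    exact ⟨this, this⟩
  · rw [if_neg hd, if_neg hd, norm_zero]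
    exact ⟨hB0, hB0⟩

/-- The truncated weight `[d ≤ B] |μ(d)| log d` is supported on squarefree numbers (and so is
`[d ≤ B] μ(d) log d`). [folklore] -/
theorem trunc_weight_ne_zero {B d : ℕ} :
    ((if d ≤ B then (((μ d : ℝ) * Real.log d : ℝ) : ℂ) else 0) ≠ 0 → Squarefree d) ∧
      ((if d ≤ B then (((|(μ d : ℝ)| * Real.log d : ℝ)) : ℂ) else 0) ≠ 0 → Squarefree d) := by
  constructor <;> intro h
  · by_contra hsq
    apply h
    rw [ArithmeticFunction.moebius_eq_zero_of_not_squarefree hsq]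
    simp
  · by_contra hsq
    apply h
    rw [ArithmeticFunction.moebius_eq_zero_of_not_squarefree hsq]
    simp

/-! ### The `k = 0` term: the total mass of the window weights -/

/-- **Total mass of the window weights.**  For `B₀, B₁ ≥ 1`, `Y ≥ 1` and real `uᵢ` with
`|uᵢ(d)| ≤ log Bᵢ` on `1 ≤ d ≤ Bᵢ`:
`Σ_{d₀ ≤ B₀, d₁ ≤ B₁} [P(d) ∧ (… ∧ d₀d₁ ≤ Y ∧ …)] |u₀(d₀)| |u₁(d₁)| ≤ log B₀ log B₁ · Y (1 + log Y)`
(lattice points under the hyperbola `d₀ d₁ ≤ Y`, `HyperbolicShell.sum_pairs_hyperbola_le`).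
[folklore] -/
theorem sum_abs_window_weight_le {B₀ B₁ : ℕ} (hB₀ : 1 ≤ B₀) (hB₁ : 1 ≤ B₁) {Y Y' Z : ℝ}
    (hY : 1 ≤ Y) (P : ℕ → ℕ → Prop) [∀ d₀ d₁, Decidable (P d₀ d₁)] (u₀ u₁ : ℕ → ℝ)
    (hu₀ : ∀ d, 1 ≤ d → d ≤ B₀ → |u₀ d| ≤ Real.log B₀)
    (hu₁ : ∀ d, 1 ≤ d → d ≤ B₁ → |u₁ d| ≤ Real.log B₁) :
    ∑ d₀ ∈ Icc 1 B₀, ∑ d₁ ∈ Icc 1 B₁,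
        |(if (P d₀ d₁ ∧ (Y' < (d₀ : ℝ) * d₁ ∧ (d₀ : ℝ) * d₁ ≤ Y ∧ Z < (d₀ : ℝ) ∧ Z < (d₁ : ℝ)))
          then u₀ d₀ * u₁ d₁ else 0 : ℝ)| ≤
      Real.log B₀ * Real.log B₁ * (Y * (1 + Real.log Y)) := by
  classical
  have hL₀ : 0 ≤ Real.log B₀ := Real.log_nonneg (by exact_mod_cast hB₀)
  have hL₁ : 0 ≤ Real.log B₁ := Real.log_nonneg (by exact_mod_cast hB₁)
  set B : ℕ := max B₀ B₁ with hB
  -- compare with the indicator of the hyperbola on the square box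
  have hterm : ∀ d₀ ∈ Icc 1 B₀, ∀ d₁ ∈ Icc 1 B₁,
      |(if (P d₀ d₁ ∧ (Y' < (d₀ : ℝ) * d₁ ∧ (d₀ : ℝ) * d₁ ≤ Y ∧ Z < (d₀ : ℝ) ∧ Z < (d₁ : ℝ)))
          then u₀ d₀ * u₁ d₁ else 0 : ℝ)| ≤
        Real.log B₀ * Real.log B₁ *
          (if ((d₀, d₁).1 : ℝ) * (d₀, d₁).2 ≤ Y then 0 / (((d₀, d₁).1 : ℝ) * (d₀, d₁).2) + 1
            else 0) := by
    intro d₀ hd₀ d₁ hd₁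
    rw [Finset.mem_Icc] at hd₀ hd₁
    split_ifs with h1 h2
    · rw [abs_mul, zero_div, zero_add, mul_one]
      exact mul_le_mul (hu₀ d₀ hd₀.1 hd₀.2) (hu₁ d₁ hd₁.1 hd₁.2) (abs_nonneg _) hL₀
    · exact absurd h1.2.2.1 h2
    · rw [abs_zero]; positivity
    · rw [abs_zero, mul_zero]
  calc ∑ d₀ ∈ Icc 1 B₀, ∑ d₁ ∈ Icc 1 B₁,
        |(if (P d₀ d₁ ∧ (Y' < (d₀ : ℝ) * d₁ ∧ (d₀ : ℝ) * d₁ ≤ Y ∧ Z < (d₀ : ℝ) ∧ Z < (d₁ : ℝ)))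
          then u₀ d₀ * u₁ d₁ else 0 : ℝ)|
      ≤ ∑ d₀ ∈ Icc 1 B₀, ∑ d₁ ∈ Icc 1 B₁, Real.log B₀ * Real.log B₁ *
          (if ((d₀, d₁).1 : ℝ) * (d₀, d₁).2 ≤ Y then 0 / (((d₀, d₁).1 : ℝ) * (d₀, d₁).2) + 1
            else 0) :=
        Finset.sum_le_sum fun d₀ hd₀ => Finset.sum_le_sum fun d₁ hd₁ => hterm d₀ hd₀ d₁ hd₁
    _ = Real.log B₀ * Real.log B₁ * ∑ p ∈ Icc 1 B₀ ×ˢ Icc 1 B₁,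
          (if (p.1 : ℝ) * p.2 ≤ Y then 0 / ((p.1 : ℝ) * p.2) + 1 else 0) := by
        rw [Finset.mul_sum, Finset.sum_product]
    _ ≤ Real.log B₀ * Real.log B₁ * ∑ p ∈ Icc 1 B ×ˢ Icc 1 B,
          (if (p.1 : ℝ) * p.2 ≤ Y then 0 / ((p.1 : ℝ) * p.2) + 1 else 0) := by
        refine mul_le_mul_of_nonneg_left ?_ (mul_nonneg hL₀ hL₁)
        refine Finset.sum_le_sum_of_subset_of_nonneg ?_ fun p _ _ => by positivity
        exact Finset.product_subset_product (Finset.Icc_subset_Icc le_rfl (le_max_left _ _))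
          (Finset.Icc_subset_Icc le_rfl (le_max_right _ _))
    _ ≤ Real.log B₀ * Real.log B₁ * (0 * (1 + Real.log Y) ^ 2 + Y * (1 + Real.log Y)) :=
        mul_le_mul_of_nonneg_left (HyperbolicShell.sum_pairs_hyperbola_le hY le_rfl B)
          (mul_nonneg hL₀ hL₁)
    _ = _ := by ring

end Pair

end Literature.NumberTheory.Sieve.LinearPairMoebius
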